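/-
Copyright (c) 2026 the pub-hodgecm-mathlib formalisation cell (harness21).  Prover seat hodgecm-mathlib-LH4-p12 (g9), req620 Track A «(D-RAM) FOUR-FRAME» squad
((β₂) road (R-36), β₂-BOARD v2 §4 «(OFF) ASSEMBLY», β₂ WORD #26 (B) «p12: hDlo»: the per-vertex letters of the UPPER line and its diagonal end — «THE RAY SCALAR IS THE LEVEL DIGIT»),
2026-09-05.
-/
import Summits.HodgeConjecture.HodgeConjecture.Theorems.F0P3cDyRamRayScalarNearlyFixed   -- ★ (LH4-p16 (g2)): `cellScalar_eq_dualGen_mul`, `add_map_div_eq_sub_map_div`; brings ★ DEFS, ★ `v_map_le_pow_iff`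
import Summits.HodgeConjecture.HodgeConjecture.Theorems.F0P3cDyRamShellLineModel          -- ★ (LH4-p16 (g0)): `latticeInLevel_endoGL_sub_one_iff_isOrd` (the level token in the line model)
import HarnessLib

/-!
# Crux `H413`, line LH4 «(D-RAM) FOUR-FRAME» — the (β₂) road (R-36), β₂-BOARD v2 row (OFF), sockets ‹HD_RAY›∕‹hU_ray› (and every cone cell): «THE RAY SCALAR OF A GLUED
# VERTEX IS ITS LEVEL DIGIT» — `jE e₀ = Tr_ρ(μ∕(cc(α − ρα)·ΘY)) = (κ − ρκ)∕(Θcc·Θ(α − ρα))`, `κ = μ∕Y`, so `|e₀|·|cc(α − ρα)| = |κ − ρκ|`, the `ρ`-clause of the level token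
# `IsOrd cc (μ∕(ϖE^ℓ·Y))` IS `|e₀| ≤ |ϖ|^ℓ`, and on the upper line (below its top digit) «exact level `ℓ₀`» ⟺ `|e₀| = |ϖ|^{ℓ₀}`

Cell `hodgecm-mathlib` (D-0151), FLOOR 0, crux item H413 = `stmt-HodgeConjecture-24833`, route of record `HCCMUnconditional`; squad F0∕P3c∕LH4; lane
`--supports stmt-HodgeConjecture-24833 --as helper` (count-neutral; pays NO tier-0 row).  THEOREMS ONLY (no `def`, no instance, no notation, no `sorry`, default heartbeats);
★-only imports; states NO law; (β₂) stays a HYPOTHESIS.  DATUM-FREE: ★ (C1)'s line model `(M, jE, ρ, Θ, α)` (`ρ`, `Θ` commuting isometric involutions, `Fix ρ ⊇ jE(E)`, `Θh = h`),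
a cell scalar `cc` with `ρcc = cc`, the dual generator `Y = dualGen ρ Θ α cc h x₀` (★ DEFS); §3 adds ★ `…ShellLineModel`'s glued-vertex frame.  NO residue field, NO `|2|`, ANY lane
(`|jE ϖ|` is never evaluated: type RamK `exp(−1)` and type RamM `exp(−2)` read the same statements).

WHY ((OFF) lead LH7-p09 (g2) BETA2-OFF-RESIDUAL v1 §3 ∕ v2: «on the UPPER line `j + m = jl + b` (`m < 2b`, `b ≤ j`) the level of a glued vertex VARIES over the cell … `|e₀|` on the
shell is NOT automatic»; this seat's census of the diagonal end `hDlo` (β₂ WORD #26 (B)): in ★ p863084's `Fix ρ`-coordinates `|B·P|` and `|A·Q|` cancel).  ★ p863440 (lower line)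
reads the ray scalar `e₀` of ★ `…RayScalarNearlyFixed`'s HEAD (`jE e₀ = Tr_ρ(μ∕D₀)`, `D₀ = cc(α − ρα)·ΘY`) through the coordinates `B·P′ − A·Q′` of `ΘY`; THIS FILE reads it
through ★ p16's own §1: `D₀ = Y·Θcc·Θ(α − ρα)` (`cellScalar_eq_dualGen_mul`) with `Θ(α − ρα)` ANTI-`ρ`-fixed and `Θcc` `ρ`-fixed, so the trace is the SKEW of the depth quotient
(`add_map_div_eq_sub_map_div`): `jE e₀ = (κ − ρκ)∕(Θcc·Θ(α − ρα))`, `κ := μ∕Y`.  Consequences, cell by cell and vertex by vertex: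
* §1 `div_cellScalar_eq` (`μ∕D₀ = κ∕(Θcc·Θ(α − ρα))`), `rayScalar_eq_skew_div` (the identity), `v_rayScalar_mul_eq` (`|t|·|cc(α − ρα)| = |κ − ρκ|` for `t = Tr_ρ(μ∕D₀)`) —
  the `t`-abstracted forms of ★ `…RowVertexRayDichotomy.{rayScalar_eq_sub_map_div, v_rayScalar_mul_eq}` (LH4-p15 (g2), the `t := jE e₀` instances; its §2 is the one-way
  level-`1` case of §3 below) — kept here so that §2–§3 need only ★ p16's two field identities.
* §2 `isOrd_div_pow_mul_iff` — THE LEVEL TOKEN IS THE RAY SCALAR: for `ρpE = pE ≠ 0`, `IsOrd ρ α cc (μ∕(pE^ℓ·Y)) ↔ (|μ| ≤ |pE^ℓ·Y| ∧ |t| ≤ |pE|^ℓ)`; `isOrd_sub_one_div_pow_iff` — the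
  `(lam − 1)`-token `IsOrd cc ((lam − 1)∕pE^ℓ) ↔ (|lam − 1| ≤ |pE|^ℓ ∧ |lam − ρlam| ≤ |cc(α − ρα)|·|pE|^ℓ)`; `isOrd_div_pow_of_le` — ray domination `μ∕pE^n ∈ 𝒪_cc` from the two
  sizes `|μ| ≤ |pE|^n`, `|μ − ρμ| ≤ |cc(α − ρα)|·|pE|^n` (on the upper line: `n := s = jl − j = m − b ≤ m`, every vertex — ★ p16's HEAD letter `hμt` at `m′ := s` on the RAY band `m⋆ ≤ s`).
* §3 HEADS over ★ `…ShellLineModel`'s glued-vertex frame with `Y := dualGen … x₀`: `latticeInLevel_iff_v_rayScalar_le` — under the three cell-constant letters at level `ℓ`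
  (`|u₀₀ − 1| ≤ |ϖ^ℓ|`, `|lam − 1| ≤ |ϖE|^ℓ`, `|lam − ρlam| ≤ |cc(α − ρα)|·|ϖE|^ℓ`) and `|μ| ≤ |ϖE^ℓ·Y|`, `LatticeInLevel ϖ ℓ (Γ − 1) L ↔ |e₀| ≤ |ϖ|^ℓ`; and
  `exactLevel_iff_v_rayScalar_eq` — with the same letters at `ℓ₀ + 1`, `(LatticeInLevel ϖ ℓ₀ (Γ − 1) L ∧ ¬ LatticeInLevel ϖ (ℓ₀ + 1) (Γ − 1) L) ↔ |e₀| = |ϖ|^{ℓ₀}`.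
READING FOR ‹HD_RAY›∕‹hU_ray› (not typed here): after ★ FILE 10 `…ShellOfExactLevel` both literals of an upper-line cell carry «exact level `ℓ₀`»; by §3 that conjunct is
`|e₀| = |ϖ|^{d % 2}` — EXACTLY the letter `he₀v` of ★ p16's HEAD `exists_fixed_unit_valueSet_endoGL_sub_one_glued_eq_smul_xPlus` (with §2's ray domination at `m′ := s ≥ m⋆` and
`hsk ⟸ 2s ≥ m_c`), so on the RAY band the counted vertices are precisely the labelled rays `VS_{m⋆} = valueSetMod σ ϖ m⋆ (e′ • X₊)`; the balance of `ω(e′)` against the weight is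
the digit engine's (LH4-p19 lineage).  On the LOWER line §1 recovers ★ p863440's `|e₀| = |ϖ|^{ℓ₀}` as «every vertex at level exactly `ℓ₀`».
HONEST LABEL.  Count-neutral valuation ∕ order algebra; nothing printed is asserted; no census law is stated; ‹HD_RAY› ‹hU_ray› (and every other band letter) stay OPEN; `HC_CM` is
proved only modulo the 7 printed citations (2 remaining named inputs: hLiu418 = `stmt-HodgeConjecture-24832`, h413 = `stmt-HodgeConjecture-24833`) until rung 0 closes.
## References
* [Serre1979] J.-P. Serre, *Local Fields*, GTM 67 (1979): Ch. III §3 Prop. 7 (trace and different), Ch. III §6 Prop. 12 (orders of conductor `c`).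
* [Jacobowitz1962] R. Jacobowitz, *Hermitian forms over local fields*, Amer. J. Math. 84 (1962): §4 (duals, gluing).
* [Kottwitz1986BaseChangeUnits] R. E. Kottwitz, *Base change for unit elements of Hecke algebras*, Compositio Math. 60 (1986): §1 pp. 240–241, §3 (congruence levels).
* [Rogawski1990] J. D. Rogawski, *Automorphic Representations of Unitary Groups in Three Variables*, Ann. of Math. Stud. 123 (1990): §4.9 Prop. 4.9.1 (b) p. 55.
-/

set_option autoImplicit false

noncomputable section

namespace Summit.HodgeConjecture.HodgeConjecture.Cruxes.H413.F0P3cDyRamUpperLineRayLetters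

open scoped Valued WithZero Matrix MatrixGroups
open WithZero
open Literature.NumberTheory.Automorphic Literature.NumberTheory.Automorphic.HermitianLattice Literature.NumberTheory.Automorphic.UnitaryLatticeTree
open Literature.NumberTheory.Rogawski1990
open Summit.HodgeConjecture.HodgeConjecture.Cruxes.H413.F0P3cDyRamToricCensusDefs
open Summit.HodgeConjecture.HodgeConjecture.Cruxes.H413.F0P3cDyRamFourFrameCensusDefs (LatticeInLevel)
open Summit.HodgeConjecture.HodgeConjecture.Cruxes.H413.F0P3cDyRamRayScalarNearlyFixed (cellScalar_eq_dualGen_mul add_map_div_eq_sub_map_div)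
open Summit.HodgeConjecture.HodgeConjecture.Cruxes.H413.F0P3cDyRamShellLineModel (latticeInLevel_endoGL_sub_one_iff_isOrd)
open Summit.HodgeConjecture.HodgeConjecture.Cruxes.H413.F0P3cDyRamDiagonalCellCleanRegime (v_map_le_pow_iff)

variable {E M : Type} [Field E] [Valued E ℤᵐ⁰] [Field M] [Valued M ℤᵐ⁰] {ρ Θ : M →+* M} {α : M}

/-! ## §1 The ray scalar is the skew of the depth quotient -/

omit [Valued M ℤᵐ⁰] in
/-- **THE CELL SCALAR DIVIDES OUT**: `μ∕(cc(α − ρα)·ΘY) = (μ∕Y)∕(Θcc·Θ(α − ρα))` for `Y = dualGen ρ Θ α cc h x₀` (`Θh = h`, `Θ² = 1`; ★ `cellScalar_eq_dualGen_mul`).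
[cite: Jacobowitz1962, §4] -/
theorem div_cellScalar_eq (hΘΘ : ∀ x, Θ (Θ x) = x) {hM : M} (hΘh : Θ hM = hM) (cc x₀ μ : M) :
    μ / (cc * (α - ρ α) * Θ (dualGen ρ Θ α cc hM x₀)) = μ / dualGen ρ Θ α cc hM x₀ / (Θ cc * Θ (α - ρ α)) := by
  rw [cellScalar_eq_dualGen_mul hΘΘ hΘh cc x₀, div_div]

omit [Valued M ℤᵐ⁰] in
/-- **«THE RAY SCALAR IS THE SKEW OF THE DEPTH QUOTIENT»**: with `κ := μ∕Y`, `Y = dualGen ρ Θ α cc h x₀`, `ρ` an involution commuting with `Θ`, `ρcc = cc`, `Θh = h`: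
`μ∕(cc(α − ρα)·ΘY) + ρ(μ∕(cc(α − ρα)·ΘY)) = (κ − ρκ)∕(Θcc·Θ(α − ρα))` — `Θcc` is `ρ`-fixed and `Θ(α − ρα)` is ANTI-`ρ`-fixed (★ `add_map_div_eq_sub_map_div`).
[cite: Serre1979, Ch. III §3 Prop. 7] [cite: Jacobowitz1962, §4] -/
theorem rayScalar_eq_skew_div (hρρ : ∀ x, ρ (ρ x) = x) (hΘΘ : ∀ x, Θ (Θ x) = x) (hΘρ : ∀ x, Θ (ρ x) = ρ (Θ x)) {hM : M} (hΘh : Θ hM = hM)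
    {cc : M} (hc : ρ cc = cc) (x₀ μ : M) {t : M}
    (ht : t = μ / (cc * (α - ρ α) * Θ (dualGen ρ Θ α cc hM x₀)) + ρ (μ / (cc * (α - ρ α) * Θ (dualGen ρ Θ α cc hM x₀)))) :
    t = (μ / dualGen ρ Θ α cc hM x₀ - ρ (μ / dualGen ρ Θ α cc hM x₀)) / (Θ cc * Θ (α - ρ α)) := by
  have hc' : ρ (Θ cc) = Θ cc := by rw [← hΘρ, hc]
  have hA : ρ (Θ (α - ρ α)) = -Θ (α - ρ α) := by rw [← hΘρ, map_sub, hρρ, ← map_neg, neg_sub]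
  rw [ht, div_cellScalar_eq hΘΘ hΘh cc x₀ μ, add_map_div_eq_sub_map_div ρ hc' hA]

/-- **`|t|·|cc(α − ρα)| = |κ − ρκ|`** for the ray scalar `t = Tr_ρ(μ∕(cc(α − ρα)·ΘY))` (`Θ` isometric, `cc(α − ρα) ≠ 0`). [cite: Serre1979, Ch. III §3 Prop. 7] -/
theorem v_rayScalar_mul_eq (hρρ : ∀ x, ρ (ρ x) = x) (hΘΘ : ∀ x, Θ (Θ x) = x) (hΘρ : ∀ x, Θ (ρ x) = ρ (Θ x)) (hvΘ : ∀ x, Valued.v (Θ x) = Valued.v x)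
    {hM : M} (hΘh : Θ hM = hM) {cc : M} (hc : ρ cc = cc) (hcc : cc * (α - ρ α) ≠ 0) (x₀ μ : M) {t : M}
    (ht : t = μ / (cc * (α - ρ α) * Θ (dualGen ρ Θ α cc hM x₀)) + ρ (μ / (cc * (α - ρ α) * Θ (dualGen ρ Θ α cc hM x₀)))) :
    Valued.v t * Valued.v (cc * (α - ρ α)) = Valued.v (μ / dualGen ρ Θ α cc hM x₀ - ρ (μ / dualGen ρ Θ α cc hM x₀)) := by
  have hΘcc : Valued.v (Θ cc * Θ (α - ρ α)) = Valued.v (cc * (α - ρ α)) := by rw [← map_mul, hvΘ]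
  have hne : Valued.v (cc * (α - ρ α)) ≠ 0 := (Valuation.ne_zero_iff _).2 hcc
  rw [rayScalar_eq_skew_div hρρ hΘΘ hΘρ hΘh hc x₀ μ ht, Valuation.map_div, hΘcc, div_mul_cancel₀ _ hne]

/-! ## §2 The level token is the ray scalar; ray domination from sizes -/

/-- **«THE LEVEL TOKEN IS THE RAY SCALAR»**: for `ρpE = pE ≠ 0`, `Y = dualGen … x₀ ≠ 0`, `cc(α − ρα) ≠ 0` and `t = Tr_ρ(μ∕(cc(α − ρα)·ΘY))`,
`IsOrd ρ α cc (μ∕(pE^ℓ·Y)) ↔ (|μ| ≤ |pE^ℓ·Y| ∧ |t| ≤ |pE|^ℓ)` — the third clause of ★ `latticeInLevel_endoGL_sub_one_iff_isOrd` at level `ℓ`, read on the ray scalar.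
[cite: Serre1979, Ch. III §6 Prop. 12] [cite: Kottwitz1986BaseChangeUnits, §3] -/
theorem isOrd_div_pow_mul_iff (hρρ : ∀ x, ρ (ρ x) = x) (hΘΘ : ∀ x, Θ (Θ x) = x) (hΘρ : ∀ x, Θ (ρ x) = ρ (Θ x))
    (hvΘ : ∀ x, Valued.v (Θ x) = Valued.v x) {hM : M} (hΘh : Θ hM = hM) {cc : M} (hc : ρ cc = cc) (hcc : cc * (α - ρ α) ≠ 0)
    {pE : M} (hρp : ρ pE = pE) (hp0 : pE ≠ 0) {x₀ : M} (hY0 : dualGen ρ Θ α cc hM x₀ ≠ 0) (μ : M) (ℓ : ℕ) {t : M}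
    (ht : t = μ / (cc * (α - ρ α) * Θ (dualGen ρ Θ α cc hM x₀)) + ρ (μ / (cc * (α - ρ α) * Θ (dualGen ρ Θ α cc hM x₀)))) :
    IsOrd ρ α cc (μ / (pE ^ ℓ * dualGen ρ Θ α cc hM x₀)) ↔
      Valued.v μ ≤ Valued.v (pE ^ ℓ * dualGen ρ Θ α cc hM x₀) ∧ Valued.v t ≤ Valued.v pE ^ ℓ := by
  set Y : M := dualGen ρ Θ α cc hM x₀ with hYdef
  have hpl0 : pE ^ ℓ ≠ 0 := pow_ne_zero ℓ hp0
  have hden0 : pE ^ ℓ * Y ≠ 0 := mul_ne_zero hpl0 hY0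
  have hvden : 0 < Valued.v (pE ^ ℓ * Y) := zero_lt_iff.2 ((Valuation.ne_zero_iff _).2 hden0)
  have hvpl : 0 < Valued.v (pE ^ ℓ) := zero_lt_iff.2 ((Valuation.ne_zero_iff _).2 hpl0)
  have hvcc : 0 < Valued.v (cc * (α - ρ α)) := zero_lt_iff.2 ((Valuation.ne_zero_iff _).2 hcc)
  -- the skew of `μ∕(pE^ℓ·Y)` is the skew of `κ = μ∕Y` divided by `pE^ℓ`
  have hskew : μ / (pE ^ ℓ * Y) - ρ (μ / (pE ^ ℓ * Y)) = (μ / Y - ρ (μ / Y)) / pE ^ ℓ := by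
    rw [map_div₀, map_mul, map_pow, hρp, map_div₀]
    field_simp
  have hne : Valued.v (cc * (α - ρ α)) ≠ 0 := (Valuation.ne_zero_iff _).2 hcc
  have hvt : Valued.v t = Valued.v (μ / Y - ρ (μ / Y)) / Valued.v (cc * (α - ρ α)) := by
    rw [← v_rayScalar_mul_eq hρρ hΘΘ hΘρ hvΘ hΘh hc hcc x₀ μ ht, mul_div_cancel_right₀ _ hne]
  rw [isOrd_iff, Valuation.map_div, div_le_one₀ hvden, hskew, Valuation.map_div, div_le_iff₀ hvpl, Valuation.map_pow, hvt,
    div_le_iff₀ hvcc, mul_comm (Valued.v (cc * (α - ρ α)))]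

/-- **THE `(lam − 1)`-TOKEN IN SIZES**: for `ρpE = pE ≠ 0`, `IsOrd ρ α cc ((lam − 1)∕pE^ℓ) ↔ (|lam − 1| ≤ |pE|^ℓ ∧ |lam − ρlam| ≤ |cc(α − ρα)|·|pE|^ℓ)` — the second clause of
★ `latticeInLevel_endoGL_sub_one_iff_isOrd` (`(lam − 1) − ρ(lam − 1) = lam − ρlam`). [cite: Serre1979, Ch. III §6 Prop. 12] -/
theorem isOrd_sub_one_div_pow_iff {cc pE : M} (hρp : ρ pE = pE) (hp0 : pE ≠ 0) (lam : M) (ℓ : ℕ) :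
    IsOrd ρ α cc ((lam - 1) / pE ^ ℓ) ↔
      Valued.v (lam - 1) ≤ Valued.v pE ^ ℓ ∧ Valued.v (lam - ρ lam) ≤ Valued.v (cc * (α - ρ α)) * Valued.v pE ^ ℓ := by
  have hpl0 : pE ^ ℓ ≠ 0 := pow_ne_zero ℓ hp0
  have hvpl : 0 < Valued.v (pE ^ ℓ) := zero_lt_iff.2 ((Valuation.ne_zero_iff _).2 hpl0)
  have hskew : (lam - 1) / pE ^ ℓ - ρ ((lam - 1) / pE ^ ℓ) = (lam - ρ lam) / pE ^ ℓ := by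
    rw [map_div₀, map_pow, hρp, map_sub, map_one]
    field_simp
    ring
  rw [isOrd_iff, Valuation.map_div, div_le_one₀ hvpl, hskew, Valuation.map_div, div_le_iff₀ hvpl, Valuation.map_pow]

/-- **RAY DOMINATION FROM SIZES**: `ρpE = pE ≠ 0`, `|μ| ≤ |pE|^n`, `|μ − ρμ| ≤ |cc(α − ρα)|·|pE|^n` ⟹ `IsOrd ρ α cc (μ∕pE^n)` — on the upper line (`|μ| = |pE|^m`,
`|μ − ρμ| = |cc(α − ρα)|·|pE|^s`, `s = jl − j = m − b ≤ m`) at `n := s`, every vertex: ★ p16's HEAD letter `hμt` with `m′ := s` (★ p863440 `isOrd_div_pow_of_line` is the lower-line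
case `n := b + ℓ₀`). [cite: Serre1979, Ch. III §6 Prop. 12] [cite: Kottwitz1986BaseChangeUnits, §1 pp. 240–241] -/
theorem isOrd_div_pow_of_le {pE : M} (hρp : ρ pE = pE) (hp0 : pE ≠ 0)
    {cc μ : M} (n : ℕ) (hμ : Valued.v μ ≤ Valued.v pE ^ n) (hanti : Valued.v (μ - ρ μ) ≤ Valued.v (cc * (α - ρ α)) * Valued.v pE ^ n) :
    IsOrd ρ α cc (μ / pE ^ n) := by
  have hpk0 : pE ^ n ≠ 0 := pow_ne_zero _ hp0
  have hvpkpos : 0 < Valued.v (pE ^ n) := zero_lt_iff.2 ((Valuation.ne_zero_iff _).2 hpk0)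
  refine ⟨?_, ?_⟩
  · rw [Valuation.map_div, div_le_one₀ hvpkpos, Valuation.map_pow]; exact hμ
  · have e : μ / pE ^ n - ρ (μ / pE ^ n) = (μ - ρ μ) / pE ^ n := by rw [map_div₀, map_pow, hρp]; field_simp
    rw [e, Valuation.map_div, div_le_iff₀ hvpkpos, Valuation.map_pow]
    exact hanti

/-! ## §3 HEADS — on a glued vertex the level token is `|e₀| ≤ |ϖ|^ℓ`, and the exact level is `|e₀| = |ϖ|^ℓ₀` -/

/-- **HEAD — «THE LEVEL OF A GLUED VERTEX IS READ ON ITS RAY SCALAR».**  ★ `…ShellLineModel`'s glued-vertex frame (plane letters `hb hpr hB hg₀ hg₀1 hprg`, line model `hφs hφi hφγ`,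
presentation `hBΛ hΛx hw₀Y` with `Y := dualGen ρ Θ α cc h x₀ ≠ 0`), `ρ`, `Θ` commuting isometric involutions, `Θh = h`, `ρcc = cc`, `cc(α − ρα) ≠ 0`, `Fix ρ ∋ jE ϖ ≠ 0`,
`|jE c| ≤ 1 ↔ |c| ≤ 1`; the ray scalar `e₀ ∈ E`, `jE e₀ = Tr_ρ(μ∕(cc(α − ρα)·ΘY))`, `μ = lam − jE u₀₀`.  AT LEVEL `ℓ` assume the three cell-constant letters `|u₀₀ − 1| ≤ |ϖ^ℓ|`,
`|lam − 1| ≤ |jE ϖ|^ℓ`, `|lam − ρlam| ≤ |cc(α − ρα)|·|jE ϖ|^ℓ` and the size `|μ| ≤ |jE ϖ^ℓ·Y|` (upper line: all four hold for `ℓ ≤ s = m − b` under the fence).  THEN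
`LatticeInLevel ϖ ℓ (Γ − 1) L ↔ |e₀| ≤ |ϖ|^ℓ`. [cite: Kottwitz1986BaseChangeUnits, §3] [cite: Serre1979, Ch. III §6 Prop. 12] [cite: Jacobowitz1962, §4] -/
theorem latticeInLevel_iff_v_rayScalar_le (hρρ : ∀ x, ρ (ρ x) = x) (hvρ : ∀ x, Valued.v (ρ x) = Valued.v x) (hΘΘ : ∀ x, Θ (Θ x) = x)
    (hΘρ : ∀ x, Θ (ρ x) = ρ (Θ x)) (hvΘ : ∀ x, Valued.v (Θ x) = Valued.v x) {ϖ : E} (hϖ : Valued.v ϖ = exp (-1 : ℤ))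
    (jE : E →+* M) (hjv : ∀ c, Valued.v (jE c) ≤ 1 ↔ Valued.v c ≤ 1) (hρϖ : ρ (jE ϖ) = jE ϖ)
    (φ : (Fin 2 → E) →+ M) (hφs : ∀ (c : E) (x : Fin 2 → E), φ (c • x) = jE c * φ x) (hφi : Function.Injective φ)
    {γ₂ : GL (Fin 2) E} {lam h : M} (hφγ : ∀ x, φ ((γ₂ : Matrix (Fin 2) (Fin 2) E) *ᵥ x) = lam * φ x) (hΘh : Θ h = h)
    {L : Submodule 𝒪[E] (Fin 3 → E)} {b : ℕ} (hb : ∀ a : E, (Pi.single 1 a : Fin 3 → E) ∈ L ↔ Valued.v a ≤ Valued.v ϖ ^ b)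
    (hpr : ∀ x ∈ L, Valued.v (x 1) * Valued.v ϖ ^ b ≤ 1)
    {B₂ : Submodule 𝒪[E] (Fin 2 → E)} {w₀ : Fin 2 → E} {g₀ : Fin 3 → E}
    (hB : B₂.map ((Matrix.toLin' (!![1, 0; 0, 0; 0, 1] : Matrix (Fin 3) (Fin 2) E)).restrictScalars 𝒪[E]) =
      L ⊓ LinearMap.ker ((LinearMap.proj (1 : Fin 3) : (Fin 3 → E) →ₗ[E] E).restrictScalars 𝒪[E]))
    (hg₀ : g₀ ∈ L) (hg₀1 : Valued.v (g₀ 1) * Valued.v ϖ ^ b = 1) (hprg : g₀ - Pi.single 1 (g₀ 1) = ![w₀ 0, 0, w₀ 1])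
    {Λ : AddSubgroup M} (hBΛ : B₂.toAddSubgroup.map φ = Λ) {cc x₀ : M} (hc : ρ cc = cc) (hcc : cc * (α - ρ α) ≠ 0) (hx₀ : x₀ ≠ 0)
    (hY0 : dualGen ρ Θ α cc h x₀ ≠ 0) (hΛx : ∀ x, x ∈ Λ ↔ ∃ z, IsOrd ρ α cc z ∧ x = x₀ * z) (hw₀Y : φ w₀ = (dualGen ρ Θ α cc h x₀)⁻¹ * x₀)
    (u : GL (Fin 1) E) (ℓ : ℕ)
    -- the three cell-constant letters at level `ℓ` and the size of `μ`
    (hul : Valued.v ((u : Matrix (Fin 1) (Fin 1) E) 0 0 - 1) ≤ Valued.v (ϖ ^ ℓ))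
    (hlam1 : Valued.v (lam - 1) ≤ Valued.v (jE ϖ) ^ ℓ)
    (hlamρ : Valued.v (lam - ρ lam) ≤ Valued.v (cc * (α - ρ α)) * Valued.v (jE ϖ) ^ ℓ)
    (hμl : Valued.v (lam - jE ((u : Matrix (Fin 1) (Fin 1) E) 0 0)) ≤ Valued.v (jE ϖ ^ ℓ * dualGen ρ Θ α cc h x₀))
    {e₀ : E} (he₀ : jE e₀ = (lam - jE ((u : Matrix (Fin 1) (Fin 1) E) 0 0)) / (cc * (α - ρ α) * Θ (dualGen ρ Θ α cc h x₀)) +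
      ρ ((lam - jE ((u : Matrix (Fin 1) (Fin 1) E) 0 0)) / (cc * (α - ρ α) * Θ (dualGen ρ Θ α cc h x₀)))) :
    LatticeInLevel ϖ ℓ ((((endoGL (γ₂, u) : GL (Fin 3) E) : Matrix (Fin 3) (Fin 3) E) - 1)) L ↔ Valued.v e₀ ≤ Valued.v ϖ ^ ℓ := by
  have hvϖ0 : Valued.v ϖ ≠ 0 := by rw [hϖ]; exact exp_ne_zero
  have hϖ0 : ϖ ≠ 0 := fun h0 => hvϖ0 (by rw [h0, map_zero])
  have hjϖ0 : jE ϖ ≠ 0 := (map_ne_zero jE).2 hϖ0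
  rw [latticeInLevel_endoGL_sub_one_iff_isOrd hvρ hϖ jE φ hφs hφi hφγ hb hpr hB hg₀ hg₀1 hprg hBΛ hx₀ hY0 hΛx hw₀Y u ℓ,
    isOrd_sub_one_div_pow_iff hρϖ hjϖ0 lam ℓ,
    isOrd_div_pow_mul_iff hρρ hΘΘ hΘρ hvΘ hΘh hc hcc hρϖ hjϖ0 hY0 _ ℓ he₀, ← v_map_le_pow_iff jE hjv hϖ0 e₀ ℓ]
  exact ⟨fun h => h.2.2.2, fun h => ⟨hul, ⟨hlam1, hlamρ⟩, hμl, h⟩⟩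

/-- **HEAD — «EXACT LEVEL `ℓ₀` IS `|e₀| = |ϖ|^{ℓ₀}`».**  Same frame; the three cell-constant letters and the size of `μ` at level `ℓ₀ + 1` (they imply the level-`ℓ₀` ones): on the
upper line `j + m = jl + b` this is `ℓ₀ + 1 ≤ s = m − b` with the fence `|u₀₀ − 1| ≤ |ϖ|^{ℓ₀+1}`, `|lam − 1| ≤ |jE ϖ|^{ℓ₀+1}` — every cell of ‹HD_RAY›∕‹hU_ray›∕‹hU_mix›∕‹HD_MIX›
(`s ≥ m_c∕2 ≥ ℓ₀ + 1`).  THEN `(LatticeInLevel ϖ ℓ₀ (Γ − 1) L ∧ ¬ LatticeInLevel ϖ (ℓ₀ + 1) (Γ − 1) L) ↔ |e₀| = |ϖ|^{ℓ₀}` — after ★ FILE 10 this is the shell conjunct of BOTH literals.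
[cite: Kottwitz1986BaseChangeUnits, §3] [cite: Serre1979, Ch. III §6 Prop. 12] [cite: Rogawski1990, §4.9 Prop. 4.9.1 (b) p. 55] -/
theorem exactLevel_iff_v_rayScalar_eq (hρρ : ∀ x, ρ (ρ x) = x) (hvρ : ∀ x, Valued.v (ρ x) = Valued.v x) (hΘΘ : ∀ x, Θ (Θ x) = x)
    (hΘρ : ∀ x, Θ (ρ x) = ρ (Θ x)) (hvΘ : ∀ x, Valued.v (Θ x) = Valued.v x) {ϖ : E} (hϖ : Valued.v ϖ = exp (-1 : ℤ))
    (jE : E →+* M) (hjv : ∀ c, Valued.v (jE c) ≤ 1 ↔ Valued.v c ≤ 1) (hρϖ : ρ (jE ϖ) = jE ϖ)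
    (φ : (Fin 2 → E) →+ M) (hφs : ∀ (c : E) (x : Fin 2 → E), φ (c • x) = jE c * φ x) (hφi : Function.Injective φ)
    {γ₂ : GL (Fin 2) E} {lam h : M} (hφγ : ∀ x, φ ((γ₂ : Matrix (Fin 2) (Fin 2) E) *ᵥ x) = lam * φ x) (hΘh : Θ h = h)
    {L : Submodule 𝒪[E] (Fin 3 → E)} {b : ℕ} (hb : ∀ a : E, (Pi.single 1 a : Fin 3 → E) ∈ L ↔ Valued.v a ≤ Valued.v ϖ ^ b)
    (hpr : ∀ x ∈ L, Valued.v (x 1) * Valued.v ϖ ^ b ≤ 1)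
    {B₂ : Submodule 𝒪[E] (Fin 2 → E)} {w₀ : Fin 2 → E} {g₀ : Fin 3 → E}
    (hB : B₂.map ((Matrix.toLin' (!![1, 0; 0, 0; 0, 1] : Matrix (Fin 3) (Fin 2) E)).restrictScalars 𝒪[E]) =
      L ⊓ LinearMap.ker ((LinearMap.proj (1 : Fin 3) : (Fin 3 → E) →ₗ[E] E).restrictScalars 𝒪[E]))
    (hg₀ : g₀ ∈ L) (hg₀1 : Valued.v (g₀ 1) * Valued.v ϖ ^ b = 1) (hprg : g₀ - Pi.single 1 (g₀ 1) = ![w₀ 0, 0, w₀ 1])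
    {Λ : AddSubgroup M} (hBΛ : B₂.toAddSubgroup.map φ = Λ) {cc x₀ : M} (hc : ρ cc = cc) (hcc : cc * (α - ρ α) ≠ 0) (hx₀ : x₀ ≠ 0)
    (hY0 : dualGen ρ Θ α cc h x₀ ≠ 0) (hΛx : ∀ x, x ∈ Λ ↔ ∃ z, IsOrd ρ α cc z ∧ x = x₀ * z) (hw₀Y : φ w₀ = (dualGen ρ Θ α cc h x₀)⁻¹ * x₀)
    (u : GL (Fin 1) E) (ℓ₀ : ℕ)
    -- the three cell-constant letters at level `ℓ₀ + 1` and the size of `μ`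
    (hul : Valued.v ((u : Matrix (Fin 1) (Fin 1) E) 0 0 - 1) ≤ Valued.v (ϖ ^ (ℓ₀ + 1)))
    (hlam1 : Valued.v (lam - 1) ≤ Valued.v (jE ϖ) ^ (ℓ₀ + 1))
    (hlamρ : Valued.v (lam - ρ lam) ≤ Valued.v (cc * (α - ρ α)) * Valued.v (jE ϖ) ^ (ℓ₀ + 1))
    (hμl : Valued.v (lam - jE ((u : Matrix (Fin 1) (Fin 1) E) 0 0)) ≤ Valued.v (jE ϖ ^ (ℓ₀ + 1) * dualGen ρ Θ α cc h x₀))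
    {e₀ : E} (he₀ : jE e₀ = (lam - jE ((u : Matrix (Fin 1) (Fin 1) E) 0 0)) / (cc * (α - ρ α) * Θ (dualGen ρ Θ α cc h x₀)) +
      ρ ((lam - jE ((u : Matrix (Fin 1) (Fin 1) E) 0 0)) / (cc * (α - ρ α) * Θ (dualGen ρ Θ α cc h x₀)))) :
    (LatticeInLevel ϖ ℓ₀ ((((endoGL (γ₂, u) : GL (Fin 3) E) : Matrix (Fin 3) (Fin 3) E) - 1)) L ∧
        ¬ LatticeInLevel ϖ (ℓ₀ + 1) ((((endoGL (γ₂, u) : GL (Fin 3) E) : Matrix (Fin 3) (Fin 3) E) - 1)) L) ↔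
      Valued.v e₀ = Valued.v ϖ ^ ℓ₀ := by
  have hvϖ0 : Valued.v ϖ ≠ 0 := by rw [hϖ]; exact exp_ne_zero
  have hϖ0 : ϖ ≠ 0 := fun h0 => hvϖ0 (by rw [h0, map_zero])
  have hjϖ0 : jE ϖ ≠ 0 := (map_ne_zero jE).2 hϖ0
  have hϖle : Valued.v ϖ ≤ 1 := by rw [hϖ, ← exp_zero, exp_le_exp]; norm_num
  have hjϖle : Valued.v (jE ϖ) ≤ 1 := (hjv ϖ).2 hϖle
  -- the level-`ℓ₀` letters from the level-`(ℓ₀ + 1)` ones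
  have hpowE : Valued.v (ϖ ^ (ℓ₀ + 1)) ≤ Valued.v (ϖ ^ ℓ₀) := by
    rw [Valuation.map_pow, Valuation.map_pow]; exact pow_le_pow_right_of_le_one' hϖle (Nat.le_succ ℓ₀)
  have hpowM : Valued.v (jE ϖ) ^ (ℓ₀ + 1) ≤ Valued.v (jE ϖ) ^ ℓ₀ := pow_le_pow_right_of_le_one' hjϖle (Nat.le_succ ℓ₀)
  have hμl' : Valued.v (lam - jE ((u : Matrix (Fin 1) (Fin 1) E) 0 0)) ≤ Valued.v (jE ϖ ^ ℓ₀ * dualGen ρ Θ α cc h x₀) :=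
    hμl.trans (by rw [Valuation.map_mul, Valuation.map_mul, Valuation.map_pow, Valuation.map_pow]; exact mul_le_mul' hpowM le_rfl)
  rw [latticeInLevel_iff_v_rayScalar_le hρρ hvρ hΘΘ hΘρ hvΘ hϖ jE hjv hρϖ φ hφs hφi hφγ hΘh hb hpr hB hg₀ hg₀1 hprg hBΛ hc hcc hx₀ hY0 hΛx hw₀Y u ℓ₀
      (hul.trans hpowE) (hlam1.trans hpowM) (hlamρ.trans (mul_le_mul' le_rfl hpowM)) hμl' he₀,
    latticeInLevel_iff_v_rayScalar_le hρρ hvρ hΘΘ hΘρ hvΘ hϖ jE hjv hρϖ φ hφs hφi hφγ hΘh hb hpr hB hg₀ hg₀1 hprg hBΛ hc hcc hx₀ hY0 hΛx hw₀Y u (ℓ₀ + 1)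
      hul hlam1 hlamρ hμl he₀]
  -- `ℤᵐ⁰` discreteness: `x ≤ exp(−ℓ₀) ∧ ¬ x ≤ exp(−ℓ₀−1) ↔ x = exp(−ℓ₀)`
  have hPnE : ∀ n : ℕ, Valued.v ϖ ^ n = exp (-(n : ℤ)) := fun n => by rw [hϖ, ← exp_nsmul]; congr 1; simp
  rw [hPnE, hPnE]
  constructor
  · rintro ⟨h1, h2⟩
    have h0 : Valued.v e₀ ≠ 0 := fun h0 => h2 (by rw [h0]; exact zero_le)
    rw [← exp_log h0, exp_le_exp] at h1 h2
    rw [← exp_log h0]; congr 1; push_cast at h1 h2 ⊢; omega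
  · intro h
    rw [h, exp_le_exp, exp_le_exp]; push_cast; omega

end Summit.HodgeConjecture.HodgeConjecture.Cruxes.H413.F0P3cDyRamUpperLineRayLetters

end
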